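import Mathlib.RingTheory.ClassGroup.Basic
import Mathlib.RingTheory.DedekindDomain.Ideal.Lemmas
import Mathlib.RingTheory.DedekindDomain.AdicValuation
import HarnessLib

/-!
# The class group is generated by the primes outside any finite set

For a Dedekind domain `R` and a finite set `S` of nonzero primes, every ideal class is a product
of classes of primes **not in `S`** (and their inverses): `Cl(R)` is generated by
`{[𝔭] : 𝔭 ∉ S}`.  Classical ("every ideal class contains an ideal prime to a given ideal",
Neukirch, *Algebraic Number Theory* I (3.?) / the strong approximation step in every treatment of
ray class groups); the proof here is the Chinese remainder theorem: for `𝔭 ∈ S` choose `a ∈ R`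
with `a ≡ π (mod 𝔭²)` for a uniformiser `π ∈ 𝔭 ∖ 𝔭²` and `a ≡ 1 (mod 𝔮)` for the other `𝔮 ∈ S`;
then `(a) = 𝔭 𝔟` with `𝔟` prime to `S`, so `[𝔭] = [𝔟]⁻¹` lies in the subgroup generated by the
primes outside `S`, and every class is a product of prime classes.  Used for
[Schoof2009, Lemma 16.2] (Thaine primes): a class is a product of Frobenius classes of primes
unramified in a given finite extension.

* `Literature.NumberTheory.NumberFields.ClassGroup.mk0_mem_of_forall_prime`  (the class of a prime `v` is
  `ClassGroup.mk0 ⟨v.asIdeal, _⟩`; no abbreviation is introduced)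
* `Literature.NumberTheory.NumberFields.ClassGroup.exists_mul_eq_span_and_forall_not_mem`
* `Literature.NumberTheory.NumberFields.ClassGroup.closure_mk0_prime_not_mem_eq_top`

## References

* J. Neukirch, *Algebraic Number Theory*, Grundlehren 322, Springer 1999, Ch. I §3 and Ch. VI §1
  (Exercise: every class of `Cl_K` contains an integral ideal prime to a given ideal). [NeukirchANT1999]
* R. Schoof, *Catalan's Conjecture*, Universitext, Springer 2009, Ch. 16, Lemma 16.2. [Schoof2009]
-/

open IsDedekindDomain nonZeroDivisors

namespace Literature.NumberTheory.NumberFields.ClassGroup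

variable {R : Type*} [CommRing R] [IsDedekindDomain R]

/-- **A class all of whose prime factors lie in a subgroup lies in that subgroup**: if `I ≠ 0`
and `[𝔭] ∈ H` for every prime `𝔭 ∣ I`, then `[I] ∈ H` (induction on the factorisation of `I`).
[folklore] -/
theorem mk0_mem_of_forall_prime (H : Subgroup (_root_.ClassGroup R)) :
    ∀ (I : Ideal R) (hI : I ≠ ⊥),
      (∀ v : HeightOneSpectrum R, v.asIdeal ∣ I → ClassGroup.mk0 ⟨v.asIdeal, mem_nonZeroDivisors_iff_ne_zero.mpr v.ne_bot⟩ ∈ H) →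
        ClassGroup.mk0 ⟨I, mem_nonZeroDivisors_iff_ne_zero.mpr hI⟩ ∈ H := by
  intro I
  refine UniqueFactorizationMonoid.induction_on_prime I ?_ ?_ ?_
  · intro h; exact absurd rfl h
  · intro u hu _ _
    have hu' : u = ⊤ := Ideal.isUnit_iff.mp hu
    subst hu'
    have h1 : (⟨(⊤ : Ideal R), mem_nonZeroDivisors_iff_ne_zero.mpr top_ne_bot⟩ : (Ideal R)⁰) = 1 :=
      Subtype.ext Ideal.one_eq_top.symm
    rw [h1, map_one]
    exact one_mem H
  · intro a p ha hp ih hpa hprimes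
    have hp0 : p ≠ ⊥ := hp.ne_zero
    set v : HeightOneSpectrum R := ⟨p, Ideal.isPrime_of_prime hp, hp0⟩ with hv
    have hmk : (⟨p * a, mem_nonZeroDivisors_iff_ne_zero.mpr hpa⟩ : (Ideal R)⁰) =
        ⟨p, mem_nonZeroDivisors_iff_ne_zero.mpr hp0⟩ * ⟨a, mem_nonZeroDivisors_iff_ne_zero.mpr ha⟩ :=
      rfl
    rw [hmk, map_mul]
    refine mul_mem ?_ (ih ha fun w hw => hprimes w (hw.mul_left p))
    exact hprimes v (dvd_mul_right p a)

/-- **Moving a prime off a finite set** (Chinese remainder theorem): for a nonzero prime `𝔭`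
and a finite set `S` of nonzero primes there are `a ≠ 0` and an ideal `𝔟` with `(a) = 𝔭 · 𝔟`
and no prime of `S` dividing `𝔟`.  (`a ≡ π (mod 𝔭²)`, `π ∈ 𝔭 ∖ 𝔭²`, and `a ≡ 1 (mod 𝔮)` for
`𝔮 ∈ S ∖ {𝔭}`.) [cite: NeukirchANT1999, Ch. I §3 (approximation theorem in Dedekind domains)] -/
theorem exists_mul_eq_span_and_forall_not_mem (v : HeightOneSpectrum R)
    (S : Finset (HeightOneSpectrum R)) :
    ∃ (a : R) (𝔟 : Ideal R), a ≠ 0 ∧ v.asIdeal * 𝔟 = Ideal.span {a} ∧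
      ∀ w ∈ S, ¬ w.asIdeal ∣ 𝔟 := by
  classical
  -- a uniformiser `π ∈ 𝔭 ∖ 𝔭²`
  haveI := v.isPrime
  obtain ⟨π, hπ1, hπ2⟩ := Ideal.exists_mem_pow_notMem_pow_succ v.asIdeal v.ne_bot
    v.isPrime.ne_top 1
  rw [pow_one] at hπ1
  -- CRT on the finite set `S ∪ {v}` with exponent `2`
  set T : Finset (HeightOneSpectrum R) := insert v S with hT
  obtain ⟨a, ha⟩ := IsDedekindDomain.exists_forall_sub_mem_ideal (s := T)
    (fun w : HeightOneSpectrum R => w.asIdeal) (fun _ => 2)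
    (fun w _ => w.prime) (fun w _ w' _ hne h => hne (HeightOneSpectrum.ext h))
    (fun w => if (w : HeightOneSpectrum R) = v then π else 1)
  have hvT : v ∈ T := Finset.mem_insert_self v S
  have hav : a - π ∈ v.asIdeal ^ 2 := by simpa using ha v hvT
  have haw : ∀ w ∈ S, w ≠ v → a - 1 ∈ w.asIdeal ^ 2 := fun w hw hne => by
    simpa [hne] using ha w (Finset.mem_insert_of_mem hw)
  -- `a ∈ 𝔭 ∖ 𝔭²`, `a ∉ 𝔮` for `𝔮 ∈ S ∖ {𝔭}`
  have ha1 : a ∈ v.asIdeal := by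
    have h := Ideal.pow_le_self two_ne_zero hav
    simpa using v.asIdeal.add_mem h hπ1
  have ha2 : a ∉ v.asIdeal ^ 2 := fun h => hπ2 (by simpa using (v.asIdeal ^ 2).sub_mem h hav)
  have ha0 : a ≠ 0 := by rintro rfl; exact ha2 (Ideal.zero_mem _)
  have haS : ∀ w ∈ S, w ≠ v → a ∉ w.asIdeal := fun w hw hne h => by
    have h1 : a - 1 ∈ w.asIdeal := Ideal.pow_le_self two_ne_zero (haw w hw hne)
    have : (1 : R) ∈ w.asIdeal := by simpa using w.asIdeal.sub_mem h h1
    exact w.isPrime.ne_top ((Ideal.eq_top_iff_one _).mpr this)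
  -- `(a) = 𝔭 𝔟`
  have hdvd : v.asIdeal ∣ Ideal.span {a} :=
    Ideal.dvd_iff_le.mpr ((Ideal.span_singleton_le_iff_mem _).mpr ha1)
  obtain ⟨𝔟, h𝔟⟩ := hdvd
  refine ⟨a, 𝔟, ha0, h𝔟.symm, fun w hw hw𝔟 => ?_⟩
  by_cases hne : w = v
  · subst hne
    apply ha2
    have : w.asIdeal ^ 2 ∣ Ideal.span {a} := by
      rw [h𝔟, pow_two]
      exact mul_dvd_mul_left _ hw𝔟
    exact (Ideal.dvd_iff_le.mp this) (Ideal.mem_span_singleton_self a)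
  · apply haS w hw hne
    have : w.asIdeal ∣ Ideal.span {a} := by rw [h𝔟]; exact hw𝔟.mul_left _
    exact (Ideal.dvd_iff_le.mp this) (Ideal.mem_span_singleton_self a)

/-- **The class group is generated by the primes outside any finite set** `S`:
`Cl(R) = ⟨[𝔮] : 𝔮 ∉ S⟩`.  For `𝔭 ∈ S`, `(a) = 𝔭 𝔟` with `𝔟` prime to `S`
(`exists_mul_eq_span_and_forall_not_mem`) gives `[𝔭] = [𝔟]⁻¹ ∈ ⟨[𝔮] : 𝔮 ∉ S⟩`; every class is
a product of prime classes. [cite: NeukirchANT1999, Ch. VI §1 (every ideal class contains an ideal prime to a given ideal)]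
[cite: Schoof2009, Ch. 16, proof of Lemma 16.2] -/
theorem closure_mk0_prime_not_mem_eq_top (S : Finset (HeightOneSpectrum R)) :
    Subgroup.closure ((fun v : HeightOneSpectrum R => ClassGroup.mk0 ⟨v.asIdeal, mem_nonZeroDivisors_iff_ne_zero.mpr v.ne_bot⟩) '' {v : HeightOneSpectrum R | v ∉ S}) = ⊤ := by
  classical
  set H := Subgroup.closure ((fun v : HeightOneSpectrum R => ClassGroup.mk0 ⟨v.asIdeal, mem_nonZeroDivisors_iff_ne_zero.mpr v.ne_bot⟩) '' {v : HeightOneSpectrum R | v ∉ S}) with hH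
  -- every prime class lies in `H`
  have hprime : ∀ v : HeightOneSpectrum R, ClassGroup.mk0 ⟨v.asIdeal, mem_nonZeroDivisors_iff_ne_zero.mpr v.ne_bot⟩ ∈ H := by
    intro v
    by_cases hv : v ∈ S
    · obtain ⟨a, 𝔟, ha0, hab, h𝔟S⟩ := exists_mul_eq_span_and_forall_not_mem v S
      have h𝔟0 : 𝔟 ≠ ⊥ := by
        rintro rfl
        rw [Ideal.mul_bot, eq_comm, Ideal.span_singleton_eq_bot] at hab
        exact ha0 hab
      have h𝔟H : ClassGroup.mk0 ⟨𝔟, mem_nonZeroDivisors_iff_ne_zero.mpr h𝔟0⟩ ∈ H :=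
        mk0_mem_of_forall_prime H 𝔟 h𝔟0 fun w hw =>
          Subgroup.subset_closure ⟨w, fun hwS => h𝔟S w hwS hw, rfl⟩
      have hinv : ClassGroup.mk0 ⟨v.asIdeal, mem_nonZeroDivisors_iff_ne_zero.mpr v.ne_bot⟩ = (ClassGroup.mk0 ⟨𝔟, mem_nonZeroDivisors_iff_ne_zero.mpr h𝔟0⟩)⁻¹ :=
        ClassGroup.mk0_eq_mk0_inv_iff.mpr ⟨a, ha0, hab⟩
      rw [hinv]
      exact H.inv_mem h𝔟H
    · exact Subgroup.subset_closure ⟨v, hv, rfl⟩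
  -- every class is a product of prime classes
  refine (Subgroup.eq_top_iff' H).mpr fun c => ?_
  obtain ⟨⟨I, hI⟩, rfl⟩ := ClassGroup.mk0_surjective c
  have hI0 : I ≠ ⊥ := mem_nonZeroDivisors_iff_ne_zero.mp hI
  exact mk0_mem_of_forall_prime H I hI0 fun v _ => hprime v

/-- Pointwise form: every class is in the subgroup generated by the classes of the primes
outside `S`. [folklore] -/
theorem mem_closure_mk0_prime_not_mem (S : Finset (HeightOneSpectrum R)) (c : _root_.ClassGroup R) :
    c ∈ Subgroup.closure ((fun v : HeightOneSpectrum R => ClassGroup.mk0 ⟨v.asIdeal, mem_nonZeroDivisors_iff_ne_zero.mpr v.ne_bot⟩) '' {v : HeightOneSpectrum R | v ∉ S}) := by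
  rw [closure_mk0_prime_not_mem_eq_top S]
  exact Subgroup.mem_top c

end Literature.NumberTheory.NumberFields.ClassGroup
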